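import Mathlib.Algebra.MvPolynomial.Division
import Literature.Computability.AlgebraicComplexity.BI17GenericBinaryFormStabilizerProofs
import HarnessLib

/-!
# Ternary forms stabilized by a non-diagonalisable matrix (Jordan-type stabilizer elements)

Theorem-only toolkit (cell `val-lit`, row BI2017-A; no definitions, no named facts) for the
dimension counts behind Bürgisser–Ikenmeyer 2017 Thm. 2.3 / App. Prop. 7.5 for TERNARY forms
(`m = 3`): the shape of a form `f ∈ Sym^d ℂ³` with `T · f = α f` for an upper triangular `T`
whose lower-right `2 × 2` block is a Jordan block `(λ b; 0 λ)`, `b ≠ 0` (tree convention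
`x_i ↦ ∑_j T_{ji} x_j`, so `x₀ ↦ T₀₀ x₀` is an exact eigen-coordinate).

* §1 Restriction to the line `x₀ = 0` (`x₀ ↦ 0`, `x_{i+1} ↦ X i`) intertwines `T` with its
  `2 × 2` block, and `x₀ ∣ f` iff the restriction vanishes (via Mathlib's `modMonomial`).
* §2 Binary Jordan eigenforms: `(λ b; 0 λ) · h = α h`, `b ≠ 0` forces `h = c x₀^d` with
  `c = 0` or `α = λ^d` (from the tree's `apply_zero_eq_of_jordan` by rescaling with a `d`-th root).
* §3 The `x₀`-adic recursion: `T · f = α f` ⇒ `f|_{x₀=0} = c x₁^d`; if moreover `x₁` is an exact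
  eigen-coordinate (`T₀₁ = 0`) then `f ∈ ℂ[x₀, x₁]` (no monomial of `f` involves `x₂`); if `T` is a
  scalar multiple `λ u` of the regular unipotent `u` (`x₁ ↦ x₀ + x₁`, `x₂ ↦ x₁ + x₂`) and
  `α ≠ λ^d`, then `f = 0`.

These are the "Jordan-type" cases of the classical count (Matsumura–Monsky 1964; for plane
quartics Chang 1978, Poonen 2005 Thm. 3) that a generic ternary form of degree `d ≥ 4` has a
trivial stabilizer; consumer: the cell's generic-ternary-quartic stabilizer theorem (BI 2017
Thm. 2.3 at `(D, m) = (4, 3)` as corrected, erratum A21). Honest framing: classical invariant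
theory bookkeeping; nothing here bears on VP versus VNP.

## References

* [BurgisserIkenmeyer2017] P. Bürgisser, C. Ikenmeyer, *Fundamental invariants of orbit closures*,
  J. Algebra 477 (2017) 390–434, §2.1 Thm. 2.3 and Appendix Prop. 7.5.
* [Poonen2005] B. Poonen, *Varieties without extra automorphisms III: hypersurfaces*, Finite
  Fields Appl. 11 (2005), Thm. 3.
-/

noncomputable section

open MvPolynomial
open scoped BigOperators

namespace Literature.Computability.AlgebraicComplexity

/-! ### §1 Restriction to `x₀ = 0` -/

section Restrict

/-- **Restriction to `x₀ = 0` intertwines an upper block-triangular substitution with its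
`2 × 2` block**: if `x₀ ↦ T₀₀ x₀` (i.e. `T₁₀ = T₂₀ = 0`), then restricting `T · f` to `x₀ = 0`
(and renaming `x₁, x₂` to the two variables of `ℂ[y₀, y₁]`) is the block `(T₁₁ T₁₂; T₂₁ T₂₂)`
applied to the restriction of `f`. (Step of the dimension count for BI 2017 Thm. 2.3 / App.
Prop. 7.5, ternary forms.) [cite: BurgisserIkenmeyer2017, §7 (Appendix) Prop. 7.5] -/
theorem aeval_cons_zero_linSubst (T : Matrix (Fin 3) (Fin 3) ℂ) (h10 : T 1 0 = 0)
    (h20 : T 2 0 = 0) (f : MvPolynomial (Fin 3) ℂ) :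
    aeval (![0, X 0, X 1] : Fin 3 → MvPolynomial (Fin 2) ℂ) (linSubst (Fin 3) ℂ T f) =
      linSubst (Fin 2) ℂ (T.submatrix Fin.succ Fin.succ)
        (aeval (![0, X 0, X 1] : Fin 3 → MvPolynomial (Fin 2) ℂ) f) := by
  have key : (aeval (![0, X 0, X 1] : Fin 3 → MvPolynomial (Fin 2) ℂ)).comp (linSubst (Fin 3) ℂ T) =
      (linSubst (Fin 2) ℂ (T.submatrix Fin.succ Fin.succ)).comp
        (aeval (![0, X 0, X 1] : Fin 3 → MvPolynomial (Fin 2) ℂ)) := by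
    apply MvPolynomial.algHom_ext
    intro i
    rw [AlgHom.comp_apply, AlgHom.comp_apply, linSubst_X, map_sum]
    simp only [map_smul, aeval_X]
    rw [Fin.sum_univ_three]
    fin_cases i
    · simp [h10, h20]
    · simp [Fin.sum_univ_two]
    · simp [Fin.sum_univ_two]
  exact congrArg (fun φ : MvPolynomial (Fin 3) ℂ →ₐ[ℂ] MvPolynomial (Fin 2) ℂ => φ f) key

/-- The restriction `x₀ ↦ 0` followed by the renaming `y_i ↦ x_{i+1}` kills exactly the monomials
divisible by `x₀`: it is reduction modulo the monomial `x₀` (Mathlib's `modMonomial`).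
(Step of the dimension count for BI 2017 Thm. 2.3 / App. Prop. 7.5, ternary forms.)
[cite: BurgisserIkenmeyer2017, §7 (Appendix) Prop. 7.5] -/
theorem rename_succ_aeval_cons_zero_eq_modMonomial (f : MvPolynomial (Fin 3) ℂ) :
    rename Fin.succ (aeval (![0, X 0, X 1] : Fin 3 → MvPolynomial (Fin 2) ℂ) f) =
      f.modMonomial (Finsupp.single 0 1) := by
  classical
  set ψ : Fin 3 → MvPolynomial (Fin 3) ℂ := fun i => if i = 0 then 0 else X i with hψ
  have hcomp : (rename Fin.succ).comp (aeval (![0, X 0, X 1] : Fin 3 → MvPolynomial (Fin 2) ℂ)) =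
      aeval ψ := by
    apply MvPolynomial.algHom_ext
    intro i
    rw [AlgHom.comp_apply, aeval_X, aeval_X]
    fin_cases i <;> simp [hψ]
  have happ : rename Fin.succ (aeval (![0, X 0, X 1] : Fin 3 → MvPolynomial (Fin 2) ℂ) f) =
      aeval ψ f := by
    rw [← AlgHom.comp_apply, hcomp]
  rw [happ]
  -- `aeval ψ` on monomials
  have hmon : ∀ (e : Fin 3 →₀ ℕ) (c : ℂ),
      aeval ψ (monomial e c) = if e 0 = 0 then monomial e c else 0 := by
    intro e c
    rw [aeval_monomial, algebraMap_eq]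
    by_cases he : e 0 = 0
    · rw [if_pos he, monomial_eq]
      congr 1
      refine Finset.prod_congr rfl fun i hi => ?_
      have hi0 : i ≠ 0 := by
        rintro rfl
        rw [Finsupp.mem_support_iff] at hi
        exact hi he
      simp [hψ, hi0]
    · rw [if_neg he]
      have h0 : (0 : Fin 3) ∈ e.support := Finsupp.mem_support_iff.mpr he
      rw [Finsupp.prod, Finset.prod_eq_zero h0, mul_zero]
      simp [hψ, he]
  ext m
  conv_lhs => rw [f.as_sum, map_sum]
  simp only [hmon, coeff_sum]
  have hterm : ∀ e ∈ f.support, coeff m (if e 0 = 0 then monomial e (coeff e f) else 0) =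
      if e = m then (if m 0 = 0 then coeff m f else 0) else 0 := by
    intro e _
    by_cases hem : e = m
    · subst hem
      by_cases he : e 0 = 0
      · rw [if_pos he, if_pos rfl, if_pos he, coeff_monomial, if_pos rfl]
      · rw [if_neg he, if_pos rfl, if_neg he, coeff_zero]
    · rw [if_neg hem]
      by_cases he : e 0 = 0
      · rw [if_pos he, coeff_monomial, if_neg hem]
      · rw [if_neg he, coeff_zero]
  rw [Finset.sum_congr rfl hterm, Finset.sum_ite_eq']
  by_cases hm : m 0 = 0
  · have hle : ¬ Finsupp.single (0 : Fin 3) 1 ≤ m := by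
      rw [Finsupp.single_le_iff]; omega
    rw [coeff_modMonomial_of_not_le _ hle, if_pos hm]
    by_cases hmf : m ∈ f.support
    · rw [if_pos hmf]
    · rw [if_neg hmf, notMem_support_iff.mp hmf]
  · have hle : Finsupp.single (0 : Fin 3) 1 ≤ m := by
      rw [Finsupp.single_le_iff]; omega
    rw [coeff_modMonomial_of_le _ hle, if_neg hm, ite_self]

/-- **`x₀ ∣ f` when the restriction of `f` to `x₀ = 0` vanishes.** (Step of the dimension count
for BI 2017 Thm. 2.3 / App. Prop. 7.5, ternary forms.) [cite: BurgisserIkenmeyer2017, §7 (Appendix) Prop. 7.5] -/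
theorem X_zero_dvd_of_aeval_cons_zero_eq_zero {f : MvPolynomial (Fin 3) ℂ}
    (h : aeval (![0, X 0, X 1] : Fin 3 → MvPolynomial (Fin 2) ℂ) f = 0) : (X 0 : MvPolynomial (Fin 3) ℂ) ∣ f := by
  rw [X_dvd_iff_modMonomial_eq_zero, ← rename_succ_aeval_cons_zero_eq_modMonomial, h, map_zero]

/-- The restriction of a form of degree `d` to `x₀ = 0` is a binary form of degree `d`.
(Step of the dimension count for BI 2017 Thm. 2.3 / App. Prop. 7.5, ternary forms.)
[cite: BurgisserIkenmeyer2017, §7 (Appendix) Prop. 7.5] -/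
theorem isHomogeneous_aeval_cons_zero {d : ℕ} {f : MvPolynomial (Fin 3) ℂ} (hf : f.IsHomogeneous d) :
    (aeval (![0, X 0, X 1] : Fin 3 → MvPolynomial (Fin 2) ℂ) f).IsHomogeneous d := by
  have h := hf.aeval (![0, X 0, X 1] : Fin 3 → MvPolynomial (Fin 2) ℂ) (n := 1) (fun i => by
    fin_cases i
    · simpa using isHomogeneous_zero (Fin 2) ℂ 1
    · simpa using isHomogeneous_X ℂ (0 : Fin 2)
    · simpa using isHomogeneous_X ℂ (1 : Fin 2))
  simpa using h

/-- If `x₀ g` is a form of degree `d + 1` then `g` is a form of degree `d`.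
(Step of the dimension count for BI 2017 Thm. 2.3 / App. Prop. 7.5, ternary forms.)
[cite: BurgisserIkenmeyer2017, §7 (Appendix) Prop. 7.5] -/
theorem isHomogeneous_of_X_mul {σ : Type*} [DecidableEq σ] {d : ℕ} {g : MvPolynomial σ ℂ} (i : σ)
    (h : (X i * g).IsHomogeneous (d + 1)) : g.IsHomogeneous d := by
  classical
  intro e he
  have hc : coeff (e + Finsupp.single i 1) (X i * g) ≠ 0 := by
    rw [coeff_X_mul', if_pos (by simp), add_tsub_cancel_right]
    exact he
  have hdeg := h hc
  rw [Finsupp.weight_apply, Finsupp.sum_add_index'] at hdeg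
  · simp only [Pi.one_apply, smul_eq_mul, mul_one, Finsupp.sum_single_index] at hdeg
    rw [Finsupp.weight_apply]
    simp only [Pi.one_apply, smul_eq_mul, mul_one]
    omega
  · intro _; simp
  · intro _ _ _; simp

end Restrict

/-! ### §2 Binary Jordan eigenforms -/

section BinaryJordan

/-- **Eigenforms of a binary Jordan block are pure powers.** If `(λ b; 0 λ) · h = α h` with
`b ≠ 0`, `λ ≠ 0` for a binary form `h` of degree `d`, then `h = c x₀^d`, and `c = 0` or
`α = λ^d`. (From the tree's `apply_zero_eq_of_jordan` — the case `α = 1` — after rescaling the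
matrix by a `d`-th root of `α⁻¹`; step of the dimension count for BI 2017 Thm. 2.3 / App.
Prop. 7.5.) [cite: BurgisserIkenmeyer2017, §7 (Appendix) Prop. 7.4 (3)] -/
theorem exists_eq_C_mul_X_pow_of_jordan_smul {d : ℕ} {h : MvPolynomial (Fin 2) ℂ}
    (hh : h.IsHomogeneous d) {l b α : ℂ} (hl : l ≠ 0) (hb : b ≠ 0)
    (hT : linSubst (Fin 2) ℂ !![l, b; 0, l] h = α • h) :
    ∃ c : ℂ, h = C c * X 0 ^ d ∧ (c = 0 ∨ α = l ^ d) := by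
  classical
  -- the action on `x₀^d`
  have hX0 : linSubst (Fin 2) ℂ !![l, b; 0, l] (X 0) = C l * X 0 := by
    rw [linSubst_X, Fin.sum_univ_two]
    simp [smul_eq_C_mul]
  have hpow : linSubst (Fin 2) ℂ !![l, b; 0, l] (X 0 ^ d) = C (l ^ d) * X 0 ^ d := by
    rw [map_pow, hX0, mul_pow, ← map_pow]
  by_cases h0 : h = 0
  · exact ⟨0, by simp [h0], Or.inl rfl⟩
  -- `α ≠ 0`: the substitution is injective
  have hdet : (!![l, b; 0, l] : Matrix (Fin 2) (Fin 2) ℂ).det ≠ 0 := by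
    rw [Matrix.det_fin_two_of]; simpa using pow_ne_zero 2 hl
  have hα : α ≠ 0 := by
    intro hα0
    rw [hα0, zero_smul] at hT
    apply h0
    have hu : IsUnit (!![l, b; 0, l] : Matrix (Fin 2) (Fin 2) ℂ).det := isUnit_iff_ne_zero.mpr hdet
    calc h = linSubst (Fin 2) ℂ ((!![l, b; 0, l])⁻¹ * !![l, b; 0, l]) h := by
            rw [Matrix.nonsing_inv_mul _ hu, linSubst_one, AlgHom.id_apply]
      _ = 0 := by rw [linSubst_mul, AlgHom.comp_apply, hT, map_zero]
  rcases Nat.eq_zero_or_pos d with hd | hd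
  · -- degree `0`: `h` is a nonzero constant, `α = 1`
    subst hd
    have htot : h.totalDegree = 0 := hh.totalDegree_le |> Nat.le_zero.mp
    obtain ⟨c, hc⟩ : ∃ c, h = C c := ⟨coeff 0 h, (totalDegree_eq_zero_iff_eq_C).mp htot⟩
    refine ⟨c, by rw [hc, pow_zero, mul_one], Or.inr ?_⟩
    rw [hc, linSubst_C, smul_eq_C_mul, ← map_mul] at hT
    have hcc : c = α * c := C_injective _ _ hT
    have hc0 : c ≠ 0 := by rintro rfl; exact h0 (by rw [hc, map_zero])
    rw [pow_zero]
    exact (mul_eq_right₀ hc0).mp hcc.symm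
  · -- degree `≥ 1`: rescale by a `d`-th root of `α⁻¹`
    obtain ⟨t, ht⟩ := IsAlgClosed.exists_pow_nat_eq α⁻¹ hd
    have ht0 : t ≠ 0 := by
      rintro rfl
      rw [zero_pow hd.ne'] at ht
      exact inv_ne_zero hα ht.symm
    have hT' : linSubst (Fin 2) ℂ !![t * l, t * b; 0, t * l] h = h := by
      have hm : (!![t * l, t * b; 0, t * l] : Matrix (Fin 2) (Fin 2) ℂ) = t • !![l, b; 0, l] := by
        ext i j; fin_cases i <;> fin_cases j <;> simp
      rw [hm, linSubst_smul_eq_pow_smul hh, hT, smul_smul, ht, inv_mul_cancel₀ hα, one_smul]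
    have hsupp := apply_zero_eq_of_jordan hh (mul_ne_zero ht0 hl) (mul_ne_zero ht0 hb) hT'
    -- so `h = c x₀^d`
    have hsub : h.support ⊆ {Finsupp.single 0 d} := by
      intro e he
      rw [Finset.mem_singleton]
      have he0 := hsupp e he
      have hdeg : e.degree = d := by
        rw [Finsupp.degree_eq_weight_one]; exact hh (mem_support_iff.mp he)
      have he01 : e 0 + e 1 = d := degIdx_fin_two_add d ⟨e, mem_degMonomials_iff.mpr hdeg⟩
      ext i
      fin_cases i
      · simpa using he0
      · simp; omega
    set c := coeff (Finsupp.single 0 d) h with hc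
    have hrepr : h = C c * X 0 ^ d := by
      rw [C_mul_X_pow_eq_monomial]
      conv_lhs => rw [h.as_sum]
      rw [Finset.sum_subset hsub (fun e _ he => by rw [notMem_support_iff.mp he, monomial_zero]),
        Finset.sum_singleton]
    refine ⟨c, hrepr, Or.inr ?_⟩
    have hc0 : c ≠ 0 := by rintro h00; exact h0 (by rw [hrepr, h00, map_zero, zero_mul])
    rw [hrepr, map_mul, linSubst_C, hpow, smul_eq_C_mul, ← mul_assoc, ← map_mul, ← mul_assoc,
      ← map_mul] at hT
    have h1 : C (c * l ^ d - α * c) * (X 0 : MvPolynomial (Fin 2) ℂ) ^ d = 0 := by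
      rw [map_sub, sub_mul, hT, sub_self]
    rw [C_mul_X_pow_eq_monomial, monomial_eq_zero, sub_eq_zero, mul_comm] at h1
    exact (mul_right_cancel₀ hc0 h1).symm

end BinaryJordan

/-! ### §3 The `x₀`-adic recursion for ternary forms -/

section Recursion

/-- **First layer**: if `T · f = α f` for a ternary form `f` of degree `d` and an upper triangular
`T` with `x₀ ↦ T₀₀ x₀` and lower-right block a Jordan block `(λ b; 0 λ)`, `b ≠ 0`, then the
restriction of `f` to `x₀ = 0` is `c x₁^d`, with `c = 0` or `α = λ^d`. (Step of the dimension
count for BI 2017 Thm. 2.3 / App. Prop. 7.5, ternary forms.) [cite: BurgisserIkenmeyer2017, §7 (Appendix) Prop. 7.5] -/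
theorem exists_restrict_eq_C_mul_X_pow {d : ℕ} {f : MvPolynomial (Fin 3) ℂ} (hf : f.IsHomogeneous d)
    {t₀₀ t₀₁ t₀₂ l b α : ℂ} (hl : l ≠ 0) (hb : b ≠ 0)
    (hT : linSubst (Fin 3) ℂ !![t₀₀, t₀₁, t₀₂; 0, l, b; 0, 0, l] f = α • f) :
    ∃ c : ℂ, rename Fin.succ (aeval (![0, X 0, X 1] : Fin 3 → MvPolynomial (Fin 2) ℂ) f) =
      C c * X 1 ^ d ∧ (c = 0 ∨ α = l ^ d) := by
  have hsub : (!![t₀₀, t₀₁, t₀₂; 0, l, b; 0, 0, l] : Matrix (Fin 3) (Fin 3) ℂ).submatrix Fin.succ Fin.succ =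
      !![l, b; 0, l] := by
    ext i j; fin_cases i <;> fin_cases j <;> rfl
  have h := congrArg (aeval (![0, X 0, X 1] : Fin 3 → MvPolynomial (Fin 2) ℂ)) hT
  rw [aeval_cons_zero_linSubst _ (by simp) (by simp), hsub, map_smul] at h
  obtain ⟨c, hc, hcα⟩ :=
    exists_eq_C_mul_X_pow_of_jordan_smul (isHomogeneous_aeval_cons_zero hf) hl hb h
  refine ⟨c, ?_, hcα⟩
  rw [hc, map_mul, rename_C, map_pow, rename_X]
  rfl

/-- A monomial in the support of `c x_i^n` is `x_i^n`. (Step of the dimension count for BI 2017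
Thm. 2.3 / App. Prop. 7.5, ternary forms.) [cite: BurgisserIkenmeyer2017, §7 (Appendix) Prop. 7.5] -/
theorem eq_single_of_mem_support_C_mul_X_pow {σ : Type*} {c : ℂ} {i : σ} {n : ℕ} {e : σ →₀ ℕ}
    (he : e ∈ (C c * X i ^ n : MvPolynomial σ ℂ).support) : e = Finsupp.single i n := by
  classical
  rw [C_mul_X_pow_eq_monomial, mem_support_iff, coeff_monomial] at he
  by_contra hne
  exact he (if_neg (Ne.symm hne))

/-- **Jordan block with two exact eigen-coordinates ⇒ the form omits `x₂`.** If
`T = (μ 0 a; 0 λ b; 0 0 λ)` (`x₀ ↦ μ x₀`, `x₁ ↦ λ x₁`, `x₂ ↦ a x₀ + b x₁ + λ x₂`; `μ, λ, b ≠ 0`)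
satisfies `T · f = α f` for a ternary form `f` of degree `d`, then no monomial of `f` involves
`x₂`, i.e. `f ∈ ℂ[x₀, x₁]_d` (a `(d+1)`-dimensional space). Proof: `x₀`-adic recursion — the
restriction to `x₀ = 0` is `c x₁^d`, and `(f - c x₁^d)/x₀` is again an eigenform. (Step of the
dimension count for BI 2017 Thm. 2.3 / App. Prop. 7.5, ternary forms.)
[cite: BurgisserIkenmeyer2017, §7 (Appendix) Prop. 7.5] -/
theorem apply_two_eq_zero_of_jordan_smul {μ l a b : ℂ} (hμ : μ ≠ 0) (hl : l ≠ 0) (hb : b ≠ 0) :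
    ∀ (d : ℕ) (f : MvPolynomial (Fin 3) ℂ) (α : ℂ), f.IsHomogeneous d →
      linSubst (Fin 3) ℂ !![μ, 0, a; 0, l, b; 0, 0, l] f = α • f → ∀ e ∈ f.support, e 2 = 0 := by
  classical
  set T : Matrix (Fin 3) (Fin 3) ℂ := !![μ, 0, a; 0, l, b; 0, 0, l] with hTdef
  have hTX0 : linSubst (Fin 3) ℂ T (X 0) = C μ * X 0 := by
    rw [linSubst_X, Fin.sum_univ_three]; simp [hTdef, smul_eq_C_mul]
  have hTX1 : linSubst (Fin 3) ℂ T (X 1) = C l * X 1 := by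
    rw [linSubst_X, Fin.sum_univ_three]; simp [hTdef, smul_eq_C_mul]
  intro d
  induction d with
  | zero =>
    intro f α hf _ e he
    have hdeg : e.degree = 0 := by
      rw [Finsupp.degree_eq_weight_one]; exact hf (mem_support_iff.mp he)
    rw [Finsupp.degree_eq_zero_iff] at hdeg
    simp [hdeg]
  | succ d ih =>
    intro f α hf hT e he
    obtain ⟨c, hc, hcα⟩ := exists_restrict_eq_C_mul_X_pow hf hl hb hT
    -- `F = f - c x₁^{d+1}` vanishes on `x₀ = 0`
    set F := f - C c * X 1 ^ (d + 1) with hF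
    have hρF : aeval (![0, X 0, X 1] : Fin 3 → MvPolynomial (Fin 2) ℂ) F = 0 := by
      apply rename_injective _ (Fin.succ_injective 2)
      rw [hF, map_sub, map_sub, hc, map_zero]
      simp
    obtain ⟨g, hg⟩ := X_zero_dvd_of_aeval_cons_zero_eq_zero hρF
    have hFhom : F.IsHomogeneous (d + 1) := by
      rw [hF]
      exact hf.sub ((isHomogeneous_X_pow (1 : Fin 3) (d + 1)).C_mul c)
    have hghom : g.IsHomogeneous d := isHomogeneous_of_X_mul 0 (hg ▸ hFhom)
    -- `T · F = α F`
    have hTF : linSubst (Fin 3) ℂ T F = α • F := by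
      rw [hF, map_sub, hT, map_mul, linSubst_C, map_pow, hTX1, mul_pow, ← map_pow, smul_sub]
      rcases hcα with h0 | hα
      · simp [h0]
      · rw [hα, smul_eq_C_mul, smul_eq_C_mul]
        ring
    -- hence `T · g = (α / μ) g`
    have hTg : linSubst (Fin 3) ℂ T g = (μ⁻¹ * α) • g := by
      rw [hg, map_mul, hTX0, smul_eq_C_mul] at hTF
      have h1 : (X 0 : MvPolynomial (Fin 3) ℂ) * (C μ * linSubst (Fin 3) ℂ T g - C α * g) = 0 := by
        linear_combination hTF
      rcases mul_eq_zero.mp h1 with h2 | h2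
      · exact absurd h2 (X_ne_zero 0)
      · rw [sub_eq_zero] at h2
        rw [smul_eq_C_mul]
        calc linSubst (Fin 3) ℂ T g = C μ⁻¹ * (C μ * linSubst (Fin 3) ℂ T g) := by
              rw [← mul_assoc, ← map_mul, inv_mul_cancel₀ hμ, map_one, one_mul]
          _ = C (μ⁻¹ * α) * g := by rw [h2, ← mul_assoc, ← map_mul]
    -- supports
    have hfe : f = X 0 * g + C c * X 1 ^ (d + 1) := by rw [← hg, hF]; ring
    rw [hfe] at he
    rcases Finset.mem_union.mp (support_add he) with he' | he'
    · rw [mem_support_iff, coeff_X_mul'] at he'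
      by_cases h0 : (0 : Fin 3) ∈ e.support
      · rw [if_pos h0] at he'
        have h3 := ih g (μ⁻¹ * α) hghom hTg _ (mem_support_iff.mpr he')
        simpa using h3
      · rw [if_neg h0] at he'
        exact absurd rfl he'
    · rw [eq_single_of_mem_support_C_mul_X_pow he']
      simp

/-- **Scalar multiple of the regular unipotent with the wrong eigenvalue ⇒ no eigenforms.** Let
`u` be the substitution `x₀ ↦ x₀`, `x₁ ↦ x₀ + x₁`, `x₂ ↦ x₁ + x₂` (regular unipotent, matrix
`(1 1 0; 0 1 1; 0 0 1)` in the tree's column convention) and `λ ≠ 0`. If `(λ u) · f = α f` for a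
ternary form `f` of degree `d` with `α ≠ λ^d`, then `f = 0`; in particular a non-zero form fixed
by `λ u` forces `λ^d = 1`. (`x₀`-adic recursion; step of the dimension count for BI 2017 Thm. 2.3
/ App. Prop. 7.5, ternary forms.) [cite: BurgisserIkenmeyer2017, §7 (Appendix) Prop. 7.5] -/
theorem eq_zero_of_smul_unipotent_smul {l : ℂ} (hl : l ≠ 0) :
    ∀ (d : ℕ) (f : MvPolynomial (Fin 3) ℂ) (α : ℂ), f.IsHomogeneous d →
      linSubst (Fin 3) ℂ !![l, l, 0; 0, l, l; 0, 0, l] f = α • f → α ≠ l ^ d → f = 0 := by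
  classical
  set T : Matrix (Fin 3) (Fin 3) ℂ := !![l, l, 0; 0, l, l; 0, 0, l] with hTdef
  have hTX0 : linSubst (Fin 3) ℂ T (X 0) = C l * X 0 := by
    rw [linSubst_X, Fin.sum_univ_three]; simp [hTdef, smul_eq_C_mul]
  intro d
  induction d with
  | zero =>
    intro f α hf hT hα
    rw [pow_zero] at hα
    have htot : f.totalDegree = 0 := Nat.le_zero.mp hf.totalDegree_le
    obtain ⟨c, hc⟩ : ∃ c, f = C c := ⟨coeff 0 f, (totalDegree_eq_zero_iff_eq_C).mp htot⟩
    rw [hc, linSubst_C, smul_eq_C_mul, ← map_mul] at hT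
    have hcc : c = α * c := C_injective _ _ hT
    have hc0 : c = 0 := by
      by_contra hc0
      exact hα ((mul_eq_right₀ hc0).mp hcc.symm)
    rw [hc, hc0, map_zero]
  | succ d ih =>
    intro f α hf hT hα
    obtain ⟨c, hc, hcα⟩ := exists_restrict_eq_C_mul_X_pow hf hl hl hT
    have hc0 : c = 0 := hcα.resolve_right hα
    have hρ : aeval (![0, X 0, X 1] : Fin 3 → MvPolynomial (Fin 2) ℂ) f = 0 := by
      apply rename_injective _ (Fin.succ_injective 2)
      rw [hc, hc0, map_zero, map_zero, zero_mul]
    obtain ⟨g, hg⟩ := X_zero_dvd_of_aeval_cons_zero_eq_zero hρ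
    have hghom : g.IsHomogeneous d := isHomogeneous_of_X_mul 0 (hg ▸ hf)
    have hTg : linSubst (Fin 3) ℂ T g = (l⁻¹ * α) • g := by
      rw [hg, map_mul, hTX0, smul_eq_C_mul] at hT
      have h1 : (X 0 : MvPolynomial (Fin 3) ℂ) * (C l * linSubst (Fin 3) ℂ T g - C α * g) = 0 := by
        linear_combination hT
      rcases mul_eq_zero.mp h1 with h2 | h2
      · exact absurd h2 (X_ne_zero 0)
      · rw [sub_eq_zero] at h2
        rw [smul_eq_C_mul]
        calc linSubst (Fin 3) ℂ T g = C l⁻¹ * (C l * linSubst (Fin 3) ℂ T g) := by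
              rw [← mul_assoc, ← map_mul, inv_mul_cancel₀ hl, map_one, one_mul]
          _ = C (l⁻¹ * α) * g := by rw [h2, ← mul_assoc, ← map_mul]
    have hα' : l⁻¹ * α ≠ l ^ d := by
      intro h
      apply hα
      rw [pow_succ, ← h, mul_comm, ← mul_assoc, mul_inv_cancel₀ hl, one_mul]
    rw [hg, ih g _ hghom hTg hα', mul_zero]

end Recursion

end Literature.Computability.AlgebraicComplexity
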